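import Mathlib

/-!
# Negative knowledge for the crux `MomentParity.QuarticGate` (stmt-AnomalousDissipation-11464):
# the polarisation SELECTION RULE behind the accidental Casimirs of small Galerkin truncations

(cdisprove g2, cycle 2.) In the invariance system `{Q, B_N} = 0` for a momentum-graded quadratic form
`Q_θ = Σ_{k+k'=θ} û(k)ᵀA(k,k')û(k')` on the level-`N` Galerkin phase space, a pair of wavevectors
`(a, b)` with `a + b = k` contributes to the monomials `û(a)û(b)û(c)` (`a+b+c = θ`) only through the
"pair transfer" vectors `(b·x) y + (a·y) x` (`x = û(a) ⊥ a`, `y = û(b) ⊥ b`; note `k·x = b·x`,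
`k·y = a·y`), paired against `A(k,c)û(c)`, which lives in `k⊥`. Exact computation (cdisprove g2,
`casimir_evidence_g2.txt`) found ONE accidental quadratic Casimir beyond `E, H` for the 18-wavevector
truncation `|k|² ≤ 2` and none for `|k|² ≤ 3, …, 9, 16`; the mechanism, made precise here:

* `pair_transfer_orthogonal_sub` — EQUAL LENGTHS MISS A POLARISATION: for `|a| = |b|` the vector `a − b`
  lies in `k⊥` (`k = a+b`) and annihilates every pair transfer; an equal-length pair constrains the block
  `A(k,·)` only in the polarisation `a × b` (this is the `|k|²=2` accident: the shell is fed only by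
  right-angle / 120° equal-length pairs);
* `eq_zero_of_forall_pair_transfer` — AND NOTHING ELSE DOES: for `a ∦ b`, `|a| ≠ |b|`, a vector of `k⊥`
  annihilating all pair transfers is zero, i.e. the pair transfers project ONTO `k⊥`. Consequently
  (block-killing lemma for any proof of `QuadRigidity N`): if the companion blocks `A(a+c,b)`, `A(b+c,a)`
  vanish or are absent, an unequal-length pair `(a,b)` forces `A(a+b, c) = 0`.

Pure vector algebra on `Fin 3 → ℝ` (`⬝ᵥ`, `⨯₃`); supports stmt-AnomalousDissipation-11464, asserts
nothing about the route's statements.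
-/

namespace Summit.AnomalousDissipation.AnomalousDissipation.Theorems.QuarticGate.Negative

open Matrix

-- `Summit.<Summit>.<Problem>` is the tree's mandated summit-side namespace (CONVENTIONS §2); for this
-- single-conjunct summit the two coincide, so the duplicate is deliberate.
set_option linter.dupNamespace false

/-- BAC–CAB: `u × (v × w) = (u·w) v − (u·v) w`. [folklore] -/
theorem cross_cross_eq_sub (u v w : Fin 3 → ℝ) :
    u ⨯₃ (v ⨯₃ w) = (u ⬝ᵥ w) • v - (u ⬝ᵥ v) • w := by
  funext i
  fin_cases i <;> simp [cross_apply, vec3_dotProduct] <;> ring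

/-- The pair transfer is orthogonal to `a − b` (for transverse amplitudes): `(a−b)·[(b·x)y + (a·y)x] = 0`
when `x ⊥ a`, `y ⊥ b`. [folklore] -/
theorem pair_transfer_orthogonal_sub (a b x y : Fin 3 → ℝ) (hx : x ⬝ᵥ a = 0) (hy : y ⬝ᵥ b = 0) :
    (a - b) ⬝ᵥ ((b ⬝ᵥ x) • y + (a ⬝ᵥ y) • x) = 0 := by
  have hx' : a ⬝ᵥ x = 0 := by rw [dotProduct_comm]; exact hx
  have hy' : b ⬝ᵥ y = 0 := by rw [dotProduct_comm]; exact hy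
  simp only [dotProduct_add, dotProduct_smul, sub_dotProduct, smul_eq_mul, hx', hy']
  ring

/-- **Equal lengths miss a polarisation.** If `|a| = |b|` then `a − b ⊥ a + b`, so `a − b` is a vector of
`(a+b)⊥` annihilating every pair transfer of the pair `(a,b)` (`pair_transfer_orthogonal_sub`): the
`(a−b)`-polarisation of the mode `k = a + b` receives nothing from this pair. [folklore] -/
theorem sub_dotProduct_add_eq_zero_of_eq_len (a b : Fin 3 → ℝ) (h : a ⬝ᵥ a = b ⬝ᵥ b) :
    (a - b) ⬝ᵥ (a + b) = 0 := by
  simp only [sub_dotProduct, dotProduct_add, dotProduct_comm b a, h]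
  ring

/-- A nonzero real 3-vector has positive self dot product. [folklore] -/
theorem dotProduct_self_pos_of_ne_zero {n : Fin 3 → ℝ} (hn : n ≠ 0) : 0 < n ⬝ᵥ n := by
  rw [vec3_dotProduct]
  by_contra hle
  push Not at hle
  have h0 : n 0 = 0 := by nlinarith [sq_nonneg (n 0), sq_nonneg (n 1), sq_nonneg (n 2)]
  have h1 : n 1 = 0 := by nlinarith [sq_nonneg (n 0), sq_nonneg (n 1), sq_nonneg (n 2)]
  have h2 : n 2 = 0 := by nlinarith [sq_nonneg (n 0), sq_nonneg (n 1), sq_nonneg (n 2)]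
  exact hn (funext fun i => by fin_cases i <;> assumption)

/-- **And nothing else does (block-killing lemma).** For `a × b ≠ 0` and `|a| ≠ |b|`, a vector
`v ⊥ a + b` annihilating every pair transfer `(b·x)y + (a·y)x` (`x ⊥ a`, `y ⊥ b`) vanishes — the pair
transfers of an unequal-length pair project ONTO `(a+b)⊥`. Used with `x, y ∈ {n, a×n, b×n}`, `n = a×b`:
the transfers contain `|n|² n` and `|n|² (a−b)×n`, and `{a+b, n, (a−b)×n}` is a basis exactly when
`|n|²(|a|²−|b|²) ≠ 0`. [folklore] -/
theorem eq_zero_of_forall_pair_transfer (a b v : Fin 3 → ℝ) (hn : a ⨯₃ b ≠ 0)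
    (hlen : a ⬝ᵥ a ≠ b ⬝ᵥ b) (hv : v ⬝ᵥ (a + b) = 0)
    (h : ∀ x y : Fin 3 → ℝ, x ⬝ᵥ a = 0 → y ⬝ᵥ b = 0 → v ⬝ᵥ ((b ⬝ᵥ x) • y + (a ⬝ᵥ y) • x) = 0) :
    v = 0 := by
  set n : Fin 3 → ℝ := a ⨯₃ b with hndef
  have hN : 0 < n ⬝ᵥ n := dotProduct_self_pos_of_ne_zero hn
  -- orthogonality bookkeeping
  have hna : n ⬝ᵥ a = 0 := by rw [hndef, dotProduct_comm]; exact dot_self_cross a b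
  have hnb : n ⬝ᵥ b = 0 := by rw [hndef, dotProduct_comm]; exact dot_cross_self a b
  have han : a ⬝ᵥ n = 0 := by rw [dotProduct_comm]; exact hna
  have hbn : b ⬝ᵥ n = 0 := by rw [dotProduct_comm]; exact hnb
  have hxa : (a ⨯₃ n) ⬝ᵥ a = 0 := by rw [dotProduct_comm]; exact dot_self_cross a n
  have hyb : (b ⨯₃ n) ⬝ᵥ b = 0 := by rw [dotProduct_comm]; exact dot_self_cross b n
  -- triple products `a·(b×n) = n·n`, `b·(a×n) = −n·n`
  have habn : a ⬝ᵥ (b ⨯₃ n) = n ⬝ᵥ n := by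
    rw [triple_product_permutation, triple_product_permutation, hndef]
  have hban : b ⬝ᵥ (a ⨯₃ n) = -(n ⬝ᵥ n) := by
    rw [triple_product_permutation, triple_product_permutation, hndef, ← cross_anticomm a b,
      dotProduct_neg]
  -- step 1: `x = n`, `y = b × n` gives `v·n = 0`
  have h1 := h n (b ⨯₃ n) hna hyb
  rw [hbn, zero_smul, zero_add, habn, dotProduct_smul, smul_eq_mul] at h1
  have hvn : v ⬝ᵥ n = 0 := by
    rcases mul_eq_zero.1 h1 with h' | h'
    · exact absurd h' hN.ne'
    · exact h'
  -- step 2: `x = a × n`, `y = b × n` gives `v·((a−b)×n) = 0`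
  have h2 := h (a ⨯₃ n) (b ⨯₃ n) hxa hyb
  rw [hban, habn, neg_smul, ← sub_eq_neg_add, ← smul_sub, dotProduct_smul, smul_eq_mul] at h2
  set w : Fin 3 → ℝ := a ⨯₃ n - b ⨯₃ n with hwdef
  have hw : w = (a - b) ⨯₃ n := by rw [hwdef, LinearMap.map_sub₂]
  have hvw : v ⬝ᵥ w = 0 := by
    rcases mul_eq_zero.1 h2 with h' | h'
    · exact absurd h' hN.ne'
    · exact h'
  -- step 3: `{a+b, n, (a−b)×n}` is a basis: det = (n·n)(|a|²−|b|²) ≠ 0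
  set M : Matrix (Fin 3) (Fin 3) ℝ := Matrix.of ![a + b, n, w] with hMdef
  have hdet : M.det = (n ⬝ᵥ n) * (a ⬝ᵥ a - b ⬝ᵥ b) := by
    rw [show M.det = Matrix.det ![a + b, n, w] from rfl, ← triple_product_eq_det, hw, cross_cross_eq_sub,
      dotProduct_sub, dotProduct_smul, dotProduct_smul, smul_eq_mul, smul_eq_mul]
    have h3 : n ⬝ᵥ (a - b) = 0 := by rw [dotProduct_sub, hna, hnb, sub_zero]
    have h4 : (a + b) ⬝ᵥ (a - b) = a ⬝ᵥ a - b ⬝ᵥ b := by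
      simp only [add_dotProduct, dotProduct_sub, dotProduct_comm b a]; ring
    have h5 : (a + b) ⬝ᵥ n = 0 := by rw [add_dotProduct, han, hbn, add_zero]
    rw [h3, h4, h5]
    ring
  have hdet0 : M.det ≠ 0 := by
    rw [hdet]
    exact mul_ne_zero hN.ne' (sub_ne_zero.2 hlen)
  have hv' : (a + b) ⬝ᵥ v = 0 := by rw [dotProduct_comm]; exact hv
  have hvn' : n ⬝ᵥ v = 0 := by rw [dotProduct_comm]; exact hvn
  have hvw' : w ⬝ᵥ v = 0 := by rw [dotProduct_comm]; exact hvw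
  have hMv : M *ᵥ v = 0 := by
    rw [hMdef, Matrix.cons_mulVec, Matrix.cons_mulVec, Matrix.cons_mulVec, Matrix.empty_mulVec,
      hv', hvn', hvw']
    simp
  exact Matrix.eq_zero_of_mulVec_eq_zero hdet0 hMv

end Summit.AnomalousDissipation.AnomalousDissipation.Theorems.QuarticGate.Negative
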